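import Mathlib
import HarnessLib
import Summits.NavierStokesRegularity.NavierStokesRegularity.Theorems.TaylorModelRungThreeCertificateIntervalDJetsArray

/-!
# Crux K1b-DR (stmt-NavierStokesRegularity-23954), line `taylor-model` — certificate SOUNDNESS tooling: rounded HORNER evaluation of
# interval polynomials and of jet-level tables (the Taylor-polynomial parts `Σ_k P_k u^k`, `Σ_k W_k h^k` of PROPAGATE-V-SPEC-cert1 §2 A/C/F/G)

Every Taylor-model clause of the v3 sub-step evaluates a polynomial whose coefficients are interval jet levels (centre polynomial `TP_s(u)`,
the one-step variational matrix `Σ_{k≤p_v} W_k(H²) h^k`, in-step ranges over `u ∈ [0,h]`) at an interval argument. This file gives the rounded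
Horner scheme `hornerR` / `evalPolyR prec coef K H` (value encloses `Σ_{k≤K} a_k u^k` whenever `a_k ∈ coef k` and `u ∈ H`: `mem_evalPolyR`) and
its array form over a table of levels, `polyLevelsA n prec Ls K H` with `mem_polyLevelsA` (coordinatewise: `Σ_{k≤K} a k c · u^k ∈ (polyLevelsA …)[c]`
when `a k c ∈ Ls[k][c]`), which composes with `mem_jet_of_jetLevelsA` / `mem_varJet_of_wColLevelsA` to enclose the Taylor polynomials of the
flow and of its first variation; `u ∈ H` covers both the endpoint `H = [h,h]` and the in-step range `H = [0,h]`.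

MODEL-lattice bookkeeping only (rung TL-M3, one finite-dimensional model ODE); nothing here concerns the Navier–Stokes equations.
-/

-- the sub-problem namespace repeats the summit name by design (D-0017)
set_option linter.dupNamespace false

namespace Summit.NavierStokesRegularity.NavierStokesRegularity.Theorems.TaylorModelCert

open scoped BigOperators

namespace IntervalD

/-! ### Rounded Horner evaluation -/

/-- Horner evaluation of the `r` coefficients starting at index `k`: `hornerR prec coef H k r ∋ Σ_{j<r} a_(k+j) u^j`. [folklore] -/
def hornerR (prec : ℕ) (coef : ℕ → IntervalD) (H : IntervalD) : ℕ → ℕ → IntervalD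
  | _, 0 => ofInt 0
  | k, r + 1 => addR prec (coef k) (mulR prec H (hornerR prec coef H (k + 1) r))

/-- Rounded interval value of the polynomial `Σ_{k≤K} coef_k · H^k` (Horner). [folklore] -/
def evalPolyR (prec : ℕ) (coef : ℕ → IntervalD) (K : ℕ) (H : IntervalD) : IntervalD := hornerR prec coef H 0 (K + 1)

/-- Soundness of the Horner recursion. [folklore] -/
theorem mem_hornerR (prec : ℕ) {coef : ℕ → IntervalD} {a : ℕ → ℝ} {H : IntervalD} {u : ℝ} (hu : mem u H) :
    ∀ (r k : ℕ), (∀ j < r, mem (a (k + j)) (coef (k + j))) →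
      mem (∑ j ∈ Finset.range r, a (k + j) * u ^ j) (hornerR prec coef H k r)
  | 0, k, _ => by simpa [hornerR] using mem_ofInt 0
  | r + 1, k, h => by
    have h0 : mem (a k) (coef k) := by simpa using h 0 (Nat.succ_pos r)
    have ih := mem_hornerR prec hu r (k + 1) fun j hj => by
      have := h (j + 1) (by omega); rwa [show k + (j + 1) = k + 1 + j from by omega] at this
    have hsum : ∑ j ∈ Finset.range (r + 1), a (k + j) * u ^ j =
        a k + u * ∑ j ∈ Finset.range r, a (k + 1 + j) * u ^ j := by
      rw [Finset.sum_range_succ', Finset.mul_sum, add_comm]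
      congr 1
      · simp
      · exact Finset.sum_congr rfl fun j _ => by rw [show k + (j + 1) = k + 1 + j from by omega, pow_succ]; ring
    rw [hsum]
    exact mem_addR prec h0 (mem_mulR prec hu ih)

/-- **Rounded Horner encloses the polynomial**: `a_k ∈ coef k` (`k ≤ K`) and `u ∈ H` give `Σ_{k≤K} a_k u^k ∈ evalPolyR prec coef K H`.
[folklore] -/
theorem mem_evalPolyR (prec : ℕ) {coef : ℕ → IntervalD} {a : ℕ → ℝ} {K : ℕ} (ha : ∀ k ≤ K, mem (a k) (coef k)) {H : IntervalD} {u : ℝ}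
    (hu : mem u H) : mem (∑ k ∈ Finset.range (K + 1), a k * u ^ k) (evalPolyR prec coef K H) := by
  have h := mem_hornerR prec hu (K + 1) 0 fun j hj => by simpa using ha j (Nat.lt_succ_iff.1 hj)
  simpa [evalPolyR] using h

/-! ### Array form over a table of levels -/

/-- Rounded Horner value, per coordinate `c < n`, of `Σ_{k≤K} Ls[k][c] · H^k`. [folklore] -/
def polyLevelsA (n prec : ℕ) (Ls : Array (Array IntervalD)) (K : ℕ) (H : IntervalD) : Array IntervalD :=
  Array.ofFn fun c : Fin n => evalPolyR prec (fun k => aget (lget Ls k) c) K H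

/-- **The Horner values of a table of levels enclose the coordinate polynomials**: if `a k c ∈ Ls[k][c]` for `k ≤ K`, `c < n` and `u ∈ H`
then `Σ_{k≤K} a k c · u^k ∈ (polyLevelsA n prec Ls K H)[c]`. [folklore] -/
theorem mem_polyLevelsA {n : ℕ} (prec : ℕ) {Ls : Array (Array IntervalD)} {K : ℕ} {a : ℕ → ℕ → ℝ}
    (ha : ∀ k ≤ K, ∀ c < n, mem (a k c) (aget (lget Ls k) c)) {H : IntervalD} {u : ℝ} (hu : mem u H) :
    ∀ c < n, mem (∑ k ∈ Finset.range (K + 1), a k c * u ^ k) (aget (polyLevelsA n prec Ls K H) c) := by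
  intro c hc
  unfold polyLevelsA
  rw [aget_ofFn _ hc]
  exact mem_evalPolyR prec (fun k hk => ha k hk c hc) hu

/-- `polyLevelsA` has size `n`. [folklore] -/
theorem size_polyLevelsA (n prec : ℕ) (Ls : Array (Array IntervalD)) (K : ℕ) (H : IntervalD) : (polyLevelsA n prec Ls K H).size = n := by
  simp only [polyLevelsA, Array.size_ofFn]

/-- The interval `[0, h]` for a nonnegative dyadic `h` contains every `u ∈ [0, h]`. [folklore] -/
theorem mem_zeroTo {h : Dyad} {u : ℝ} (h0 : 0 ≤ u) (h1 : u ≤ h.toReal) : mem u ⟨Dyad.ofInt 0, h⟩ :=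
  ⟨by simpa using h0, h1⟩

/-- **Taylor polynomial of a jet family over a table**: with the state levels of `jetLevelsA` (hypotheses of `mem_jet_of_jetLevelsA`) and
`u ∈ H`, the coordinate Taylor polynomials `Σ_{k≤K} rd (T y k) c · u^k` lie in `polyLevelsA n prec (jetLevelsA n QBA prec Y K) K H`. [folklore] -/
theorem mem_taylorPoly_of_jetLevelsA {V : Type*} {rd : V → ℕ → ℝ} {Q : V → V → V} {n : ℕ} {T : V → ℕ → V}
    (hT0 : ∀ x, ∀ c < n, rd (T x 0) c = rd x c)
    (hTs : ∀ x (k : ℕ), ∀ c < n, ((k : ℝ) + 1) * rd (T x (k + 1)) c =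
      ∑ i ∈ Finset.range (k + 1), rd (Q (T x i) (T x (k - i))) c)
    {QBA : Array IntervalD → Array IntervalD → Array IntervalD} (hQBA : IsFieldEnclosureA rd Q n QBA)
    (prec K : ℕ) {Y : Array IntervalD} (hY : Y.size = n) {y : V} (hy : ∀ c < n, mem (rd y c) (aget Y c))
    {H : IntervalD} {u : ℝ} (hu : mem u H) :
    ∀ c < n, mem (∑ k ∈ Finset.range (K + 1), rd (T y k) c * u ^ k)
      (aget (polyLevelsA n prec (jetLevelsA n QBA prec Y K) K H) c) :=
  mem_polyLevelsA prec (fun k hk c hc => mem_jet_of_jetLevelsA hT0 hTs hQBA prec K hY hy k hk c hc) hu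

end IntervalD

end Summit.NavierStokesRegularity.NavierStokesRegularity.Theorems.TaylorModelCert
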